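import Literature.MathematicalPhysics.QuantumFieldTheory.Balaban1983to89.Node00.CarriersB8SubBPCutP5
import Literature.MathematicalPhysics.QuantumFieldTheory.Balaban1983to89.B8Admissible134Periodize
import Literature.MathematicalPhysics.QuantumFieldTheory.Balaban1983to89.B8IdxB8SubDPrintClassGap

/-!
# NODE 00 (YM-PLAN Track A) — THE PRINT-CLASS CUTS («κ-PIN», director-ym №220 (A-4)): the (1.5)-obeying admissible sub-index `IdxB8SubD θ` and its periodic twin `IdxB8SubDPer θ P`
# CUT TO [Balaban1985RegularSpaces]'s LITERAL (1.3)–(1.4) class `Admissible134 θ.L M₁ R` WITH THE BLOCK SIZE `M₁` PINNED — `IdxB8SubDκ θ M₁ R`, `IdxB8SubDPerκ θ P M₁ R`; faces in print's and in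
# [Balaban1984PropagatorsII] (2.2)'s currency; NON-VACUITY at every depth; the ℤᵈ P₂D slot of record READ ON THE CUT `B8LeafOfRecordSubBP₂Dκ`, implied by the uncut slot

[Balaban1985RegularSpaces] = T. Bałaban, *Spaces of regular gauge field configurations on a lattice and gauge fixing conditions*, Commun. Math. Phys. **99** (1985) 75–102 — p. 77,
verbatim: «We consider a sequence of domains (see also [2.II, 4]) Ω₀ ⊃ Ω₁ ⊃ Ω₂ ⊃ … ⊃ Ω_k, Ω_j ⊂ T_η, j = 0, 1, …, k, (1.3) which satisfy the following conditions: Ω_j = Bʲ(Ω_j^{(j)}),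
Ω_j is a sum of cubes of a size M₁Lʲη, (Lʲη)⁻¹dist(Ω_jᶜ, Ω_{j+1}) > RM₁ (1.4)» and «M₁ … is fixed in [4]»; Lemma 1 – Thm 8 pp. 79–101.  [Balaban1984PropagatorsII] (2.1)–(2.2) p. 224
(the separation class `Sep22Zd` of NODE N06's suppliers).  [Balaban1987RG1] (0.1) p. 251 (the torus).

NODE 00 CARRIER MODULE (width seat `pub-ymgap-dag-n05-w1` g4, 2026-08-28 — director-ym №220 (A-4): «PREPARE NOW, BELOW DISPLAY, EITHER WAY: n05-w1 pins the print-class periodic index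
`IdxB8SubDPerκ := {j : IdxB8SubDPer θ P ∕∕ Admissible134 θ.L M₁ R j.k j.Ω}` with the block size PINNED at the one `M := M₁ ≥ M₃` print uses and `(M₁, R)` = N06's `Sep22Zd` pair
+ its slot carrier, in `Node00∕CarriersB8SubDPer` or a sibling module»; dag-n05-d g14 exit 2 (I.39068): «index `{j : IdxB8SubD(Per) θ (P) ∕∕ Admissible134 θ.L M₁ R j.k j.Ω}` … on the
(β′) road the SAME cut applies»).  LANDED DEFINITIONS ARE IMMUTABLE: this is a NEW sibling module; `IdxB8SubD` (dag-n05-w1 g2), `IdxB8SubDPer` (g3), the ℤᵈ δ₂-slot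
`B8LeafOfRecordSubBP₂D` ∕ `ResidB8.cutSubBP₅` (g2), dag-n05-w2's `B8IdxB8SubDPrintClassGap` ∕ `B8Admissible134Sep22ZdDictionary` ∕ `B8Admissible134Periodize` and r13's
`B8Eq134Admissible.Admissible134` are CONSUMED BY NAME, nothing edited; no statement ∕ rung text touched (the edition A-5 is plan g86's, ON TRIGGER Q-SG1 = «SURVIVES» only).

WHY A CUT (FLAG №10, ref-L READ #550 on p628350, kernel-certified): `IdxB8SubD θ ⊋` print's class for every print-regime `(M₁, R)`
(`B8IdxB8SubDPrintClassGap.exists_idxB8SubD_not_admissible134`); the N05 socket families and junction binders indexed by `IdxB8SubD(Per)` therefore quantify [4]-type conclusions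
over members OUTSIDE print's hypothesis class.  Exit 2 = CUT the index to the class by ONE `Subtype`; the block size is PINNED as a parameter `M₁` because print's class carries
N06's big-block size («fixed in [4]») while the junction binders quantify `∀ M ≥ M₃` inside — consumers read them at `M⋆ := max 1 (max M₁ M₃)` (dag-n05-d's knits).

## WHAT IS DEFINED ∕ PROVED (kernel, 0 sorry; 3 definitions + faces; no `instance`, no `notation`)

* §1 ★ `IdxB8SubDκ θ M₁ R` (the ℤᵈ P₂D road's cut) · ★★ `IdxB8SubDPerκ θ P M₁ R` (№220 (A-4) VERBATIM, the (β′-PERIODIC) road's cut); the forgetful maps `toSubD ∕ toPer ∕ toSubDκ ∕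
  toZdIdx ∕ toIdxB8`, the class faces `admissible ∕ nested ∕ beyond ∕ bigCubes ∕ metric`, monotonicity in `R` (`ofLE`), the laws inherited (`domainSeq ∕ lawsB ∕ Ω_zero ∕ periodic ∕
  pos ∕ dvd`), THE N06 CURRENCY `sep22Zd` ([B6] (2.2) at every truncation `m ≤ k` and every `⌈M⌉₊ ≤ M₁`, dag-n05-w2's dictionary BY NAME), and NON-VACUITY ★ `exists_idxB8SubDκ_depth` ∕
  `nonempty_idxB8SubDκ` (`1 ≤ M₁`, `θ.L ≤ R·M₁`) · ★ `exists_idxB8SubDPerκ_depth` ∕ `nonempty_idxB8SubDPerκ` (+ `0 < P`, `M₁·θ.Lᵏ ∣ P`) — the cut rows are INHABITED at every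
  depth (dag-n05-w2's A2 `exists_idxB8SubD_admissible134` ∕ `exists_idxB8SubDPer_admissible134` BY NAME).
* §2 ★ `B8LeafOfRecordSubBP₂Dκ θ M₁ R lam` — the ℤᵈ P₂D SLOT OF RECORD `CarriersB8SubBP2D.B8LeafOfRecordSubBP₂D` (Slot8's leaf shape `B8LeafRSC` at `c₇OfRecord θ`, print's pinned
  tower-wise axial map) WITH ITS INDEX CUT to `IdxB8SubDκ θ M₁ R`, every other token identical; ★ `b8LeafOfRecordSubBP₂Dκ_of_subBP₂D` (the uncut slot implies the cut one —
  restriction along `Subtype.val`, conjunct-wise) and the layer-keyed reading `b8LeafOfRecordSubBP₂Dκ_cutSubBP₅_of_subBP₂D` at Slot8's own layer `lam.cutSubBP₅ c₁ ρ₀`.  The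
  periodic κ-slot (the RS leaf over `famB8OfRecordSubBP₂DPer ∘ Subtype.val`, pin, doors) is the sibling module `Node00/CarriersB8SubBP2DPerKappa` on top of P2′.

HONEST FRAMING: `Subtype` cuts + `rfl` ∕ restriction bookkeeping; NO estimate; nothing of [Balaban1985RegularSpaces] asserted; the κ-slot is a PROPOSITION, not proved; FLAG №10 is
NOT closed by a definition (the deciding question Q-SG1 is ref-L ∕ dag-n05-w2's; the statement edition is plan's, on trigger); N05 NOT discharged; counts unmoved; one finite T⁴
programme at fixed ε, Bałaban AS PRINTED — NOT continuum ∕ ℝ⁴ ∕ OS ∕ mass gap ∕ Clay.  No `sorry`, no `axiom`, no `instance`, no `notation`. -/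

noncomputable section

namespace Literature.MathematicalPhysics.QuantumFieldTheory.Balaban1983to89.Node00

open B7Prop1Explicit B7Prop1Local
open B8LeafModelZd (ZdIdx)
open B8ConstraintBonds (DomainSeq)
open B8IdxB8LawsB (IdxB8LawsB)
open B8LeafKnitRSC (B8LeafRSC)
open B8LeafModelZd3P2 (zdGF3P₂ zdGF3HP₂)
open B8Lemma1NonAbelian (blockPairNA)
open B8Prop7TowerAxialRecord (toAxialTowerResid)
open B8SectAStatements (MetricClause14)
open B8Eq134Admissible (Admissible134 BigCubes14 supDist)
open B9SupplySockB9P3ZdFrame (memZd Sep22Zd)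
open T4TermwiseTorus (IsPeriodic)

/-! ## §1. The print-class cuts of the two indices of record, block size pinned; faces; non-vacuity -/

section Cut

variable (θ : Stage3Params)

/-- ★ **THE PRINT-CLASS CUT OF THE (1.5)-OBEYING ADMISSIBLE SUB-INDEX** (the ℤᵈ P₂D road's index): the members `j : IdxB8SubD θ` whose domain sequence satisfies print's LITERAL
(1.3)–(1.4) `Admissible134 θ.L M₁ R k Ω` at the PINNED big-cube size `M₁` and separation constant `R` — «Ω_j is a sum of cubes of a size M₁Lʲη, (Lʲη)⁻¹dist(Ω_jᶜ, Ω_{j+1}) > RM₁».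
[cite: Balaban1985RegularSpaces, (1.3)–(1.4) p.77 («M₁ … fixed in [4]»)] -/
def IdxB8SubDκ (M₁ R : ℕ) : Type :=
  {j : IdxB8SubD θ // Admissible134 θ.L M₁ R j.1.1.1.1.k j.1.1.1.1.Ω}

/-- ★★ **THE PRINT-CLASS CUT OF THE PERIODIC (1.5)-INDEX** (director-ym №220 (A-4) verbatim; the (β′-PERIODIC) road's index): the members `j : IdxB8SubDPer θ P` (domains
`P`-periodic, `Lᵏ ∣ P`, `0 < P`) whose domain sequence satisfies print's LITERAL (1.3)–(1.4) at the PINNED `(M₁, R)`.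
[cite: Balaban1985RegularSpaces, (1.3)–(1.4) p.77, p.77 («Ω_j ⊂ T_η»); Balaban1987RG1, (0.1) p.251] -/
def IdxB8SubDPerκ (P M₁ R : ℕ) : Type :=
  {j : IdxB8SubDPer θ P // Admissible134 θ.L M₁ R j.1.1.1.1.1.k j.1.1.1.1.1.Ω}

variable {θ} {P M₁ R : ℕ}

/-- The forgetful map to the (1.5)-obeying admissible sub-index (`Subtype.val`). [cite: Balaban1985RegularSpaces, (1.3)–(1.5) p.77 (bookkeeping)] -/
def IdxB8SubDκ.toSubD (j : IdxB8SubDκ θ M₁ R) : IdxB8SubD θ := j.1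

/-- [cite: Balaban1985RegularSpaces, (1.3)–(1.5) p.77 (bookkeeping)] -/
theorem IdxB8SubDκ.toSubD_eq (j : IdxB8SubDκ θ M₁ R) : j.toSubD = j.1 := rfl

/-- The member's geometry `(η, k, {Ω_l}, Λ, 𝔅)` (`rfl` face). [cite: Balaban1985RegularSpaces, (1.3)–(1.5) p.77 (bookkeeping)] -/
def IdxB8SubDκ.toZdIdx (j : IdxB8SubDκ θ M₁ R) : ZdIdx θ.D θ.L := j.1.1.1.1.1

/-- [cite: Balaban1985RegularSpaces, (1.3)–(1.5) p.77 (bookkeeping)] -/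
theorem IdxB8SubDκ.toZdIdx_eq (j : IdxB8SubDκ θ M₁ R) : j.toZdIdx = j.1.1.1.1.1 := rfl

/-- **Print's (1.3)–(1.4) holds at a cut member** (the cut's text). [cite: Balaban1985RegularSpaces, (1.3)–(1.4) p.77] -/
theorem IdxB8SubDκ.admissible (j : IdxB8SubDκ θ M₁ R) : Admissible134 θ.L M₁ R j.1.1.1.1.1.k j.1.1.1.1.1.Ω := j.2

/-- (1.4)₂ «Ω_j is a sum of cubes of a size M₁Lʲη» at a cut member. [cite: Balaban1985RegularSpaces, (1.4) p.77] -/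
theorem IdxB8SubDκ.bigCubes (j : IdxB8SubDκ θ M₁ R) : BigCubes14 θ.L M₁ j.1.1.1.1.1.Ω := j.2.bigCubes

/-- (1.4)₃ «(Lʲη)⁻¹dist(Ω_jᶜ, Ω_{j+1}) > RM₁» at a cut member. [cite: Balaban1985RegularSpaces, (1.4) p.77] -/
theorem IdxB8SubDκ.metric (j : IdxB8SubDκ θ M₁ R) : MetricClause14 supDist j.1.1.1.1.1.Ω j.1.1.1.1.1.k 1 θ.L R M₁ := j.2.metric

/-- The sequence stops at depth `k` at a cut member. [cite: Balaban1985RegularSpaces, (1.3) p.77] -/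
theorem IdxB8SubDκ.beyond (j : IdxB8SubDκ θ M₁ R) {l : ℕ} (hl : j.1.1.1.1.1.k < l) : j.1.1.1.1.1.Ω l = ∅ := j.2.beyond l hl

/-- «R sufficiently large»: a cut member at `R` is a cut member at every `R′ ≤ R`. [cite: Balaban1985RegularSpaces, (1.4) p.77 («R is a sufficiently large positive integer»)] -/
def IdxB8SubDκ.ofLE (j : IdxB8SubDκ θ M₁ R) {R' : ℕ} (hR : R' ≤ R) : IdxB8SubDκ θ M₁ R' := ⟨j.1, j.2.of_le hR⟩

/-- [cite: Balaban1985RegularSpaces, (1.4) p.77 (bookkeeping)] -/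
theorem IdxB8SubDκ.ofLE_val (j : IdxB8SubDκ θ M₁ R) {R' : ℕ} (hR : R' ≤ R) : (j.ofLE hR).1 = j.1 := rfl

/-- The laws of the uncut index are inherited: admissibility `DomainSeq`. [cite: Balaban1985RegularSpaces, (1.3)–(1.4) p.77] -/
theorem IdxB8SubDκ.domainSeq (j : IdxB8SubDκ θ M₁ R) : DomainSeq θ.L j.1.1.1.1.1.Ω := j.1.domainSeq

/-- … the located laws №1–№8. [cite: Balaban1985RegularSpaces, (1.5)–(1.6) p.77] -/
theorem IdxB8SubDκ.lawsB (j : IdxB8SubDκ θ M₁ R) : IdxB8LawsB θ.L j.1.1.1.1.1 := j.1.lawsB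

/-- … `Ω₀ = ℤᵈ` (print's admitted «Ω_j = T_η»). [cite: Balaban1985RegularSpaces, p.77] -/
theorem IdxB8SubDκ.Ω_zero (j : IdxB8SubDκ θ M₁ R) : j.1.1.1.1.1.Ω 0 = Set.univ := j.1.Ω_zero

/-- ★ **THE CUT MEMBER IN NODE N06's CURRENCY**: [Balaban1984PropagatorsII] (2.2) `Sep22Zd R` at block parameter `M` for every `⌈M⌉₊ ≤ M₁` and every truncation `m ≤ k` (dag-n05-w2's
dictionary `IdxB8SubD.sep22Zd_of_admissible134` BY NAME) — the `(M₁, R)` of the cut IS N06's `(M, R)`. [cite: Balaban1985RegularSpaces, (1.4) p.77; Balaban1984PropagatorsII, (2.2) p.224] -/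
theorem IdxB8SubDκ.sep22Zd (j : IdxB8SubDκ θ M₁ R) {m : ℕ} (hm : m ≤ j.1.1.1.1.1.k) {M : ℝ} (hM : ⌈M⌉₊ ≤ M₁) : Sep22Zd R (memZd M j.1.1.1.1.1 m) :=
  B8Admissible134Sep22ZdDictionary.IdxB8SubD.sep22Zd_of_admissible134 j.1 j.2 hm hM

/-- The forgetful map of the periodic cut to the periodic index (`Subtype.val`). [cite: Balaban1985RegularSpaces, (1.3)–(1.5) p.77, p.77 («Ω_j ⊂ T_η») (bookkeeping)] -/
def IdxB8SubDPerκ.toPer (j : IdxB8SubDPerκ θ P M₁ R) : IdxB8SubDPer θ P := j.1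

/-- [cite: Balaban1985RegularSpaces, (1.3)–(1.5) p.77 (bookkeeping)] -/
theorem IdxB8SubDPerκ.toPer_eq (j : IdxB8SubDPerκ θ P M₁ R) : j.toPer = j.1 := rfl

/-- The forgetful map of the periodic cut to the ℤᵈ cut (forget periodicity, keep the class). [cite: Balaban1985RegularSpaces, (1.3)–(1.5) p.77 (bookkeeping)] -/
def IdxB8SubDPerκ.toSubDκ (j : IdxB8SubDPerκ θ P M₁ R) : IdxB8SubDκ θ M₁ R := ⟨j.1.1, j.2⟩

/-- [cite: Balaban1985RegularSpaces, (1.3)–(1.5) p.77 (bookkeeping)] -/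
theorem IdxB8SubDPerκ.toSubDκ_val (j : IdxB8SubDPerκ θ P M₁ R) : j.toSubDκ.1 = j.1.1 := rfl

/-- The member's geometry (`rfl` face; equals `j.toPer.toZdIdx`). [cite: Balaban1985RegularSpaces, (1.3)–(1.5) p.77 (bookkeeping)] -/
def IdxB8SubDPerκ.toZdIdx (j : IdxB8SubDPerκ θ P M₁ R) : ZdIdx θ.D θ.L := j.1.1.1.1.1.1

/-- [cite: Balaban1985RegularSpaces, (1.3)–(1.5) p.77 (bookkeeping)] -/
theorem IdxB8SubDPerκ.toZdIdx_eq (j : IdxB8SubDPerκ θ P M₁ R) : j.toZdIdx = j.toPer.toZdIdx := rfl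

/-- The member in the `Ω₀ = ℤᵈ` index `IdxB8 θ` (for the ℤᵈ family of record). [cite: Balaban1985RegularSpaces, (1.3)–(1.5) p.77 (bookkeeping)] -/
def IdxB8SubDPerκ.toIdxB8 (j : IdxB8SubDPerκ θ P M₁ R) : IdxB8 θ := j.1.1.1.1.1

/-- [cite: Balaban1985RegularSpaces, (1.3)–(1.5) p.77 (bookkeeping)] -/
theorem IdxB8SubDPerκ.toIdxB8_val (j : IdxB8SubDPerκ θ P M₁ R) : j.toIdxB8.1 = j.toZdIdx := rfl

/-- **Print's (1.3)–(1.4) holds at a periodic cut member** (the cut's text). [cite: Balaban1985RegularSpaces, (1.3)–(1.4) p.77] -/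
theorem IdxB8SubDPerκ.admissible (j : IdxB8SubDPerκ θ P M₁ R) : Admissible134 θ.L M₁ R j.1.1.1.1.1.1.k j.1.1.1.1.1.1.Ω := j.2

/-- (1.4)₂ at a periodic cut member. [cite: Balaban1985RegularSpaces, (1.4) p.77] -/
theorem IdxB8SubDPerκ.bigCubes (j : IdxB8SubDPerκ θ P M₁ R) : BigCubes14 θ.L M₁ j.1.1.1.1.1.1.Ω := j.2.bigCubes

/-- (1.4)₃ at a periodic cut member. [cite: Balaban1985RegularSpaces, (1.4) p.77] -/
theorem IdxB8SubDPerκ.metric (j : IdxB8SubDPerκ θ P M₁ R) : MetricClause14 supDist j.1.1.1.1.1.1.Ω j.1.1.1.1.1.1.k 1 θ.L R M₁ := j.2.metric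

/-- The sequence stops at depth `k` at a periodic cut member. [cite: Balaban1985RegularSpaces, (1.3) p.77] -/
theorem IdxB8SubDPerκ.beyond (j : IdxB8SubDPerκ θ P M₁ R) {l : ℕ} (hl : j.1.1.1.1.1.1.k < l) : j.1.1.1.1.1.1.Ω l = ∅ := j.2.beyond l hl

/-- «R sufficiently large»: monotonicity of the periodic cut in `R`. [cite: Balaban1985RegularSpaces, (1.4) p.77] -/
def IdxB8SubDPerκ.ofLE (j : IdxB8SubDPerκ θ P M₁ R) {R' : ℕ} (hR : R' ≤ R) : IdxB8SubDPerκ θ P M₁ R' := ⟨j.1, j.2.of_le hR⟩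

/-- [cite: Balaban1985RegularSpaces, (1.4) p.77 (bookkeeping)] -/
theorem IdxB8SubDPerκ.ofLE_val (j : IdxB8SubDPerκ θ P M₁ R) {R' : ℕ} (hR : R' ≤ R) : (j.ofLE hR).1 = j.1 := rfl

/-- The periodic laws are inherited: every `Ω_l` is `P`-periodic … [cite: Balaban1985RegularSpaces, p.77 («Ω_j ⊂ T_η»); Balaban1987RG1, (0.1) p.251] -/
theorem IdxB8SubDPerκ.periodic (j : IdxB8SubDPerκ θ P M₁ R) (l : ℕ) : IsPeriodic P (fun x : B7Prop1Explicit.Site θ.D => x ∈ j.1.1.1.1.1.1.Ω l) :=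
  j.1.periodic l

/-- … `0 < P` … [cite: Balaban1985RegularSpaces, p.77 («Ω_j ⊂ T_η») (bookkeeping)] -/
theorem IdxB8SubDPerκ.pos (j : IdxB8SubDPerκ θ P M₁ R) : 0 < P := j.1.pos

/-- … the tiling law `θ.Lᵏ ∣ P` … [cite: Balaban1985RegularSpaces, p.77 (bookkeeping)] -/
theorem IdxB8SubDPerκ.dvd (j : IdxB8SubDPerκ θ P M₁ R) : θ.L ^ j.1.1.1.1.1.1.k ∣ P := j.1.dvd

/-- … admissibility `DomainSeq` … [cite: Balaban1985RegularSpaces, (1.3)–(1.4) p.77] -/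
theorem IdxB8SubDPerκ.domainSeq (j : IdxB8SubDPerκ θ P M₁ R) : DomainSeq θ.L j.1.1.1.1.1.1.Ω := j.1.domainSeq

/-- … the located laws №1–№8 … [cite: Balaban1985RegularSpaces, (1.5)–(1.6) p.77] -/
theorem IdxB8SubDPerκ.lawsB (j : IdxB8SubDPerκ θ P M₁ R) : IdxB8LawsB θ.L j.1.1.1.1.1.1 := j.1.lawsB

/-- … `Ω₀ = ℤᵈ`. [cite: Balaban1985RegularSpaces, p.77] -/
theorem IdxB8SubDPerκ.Ω_zero (j : IdxB8SubDPerκ θ P M₁ R) : j.1.1.1.1.1.1.Ω 0 = Set.univ := j.1.Ω_zero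

/-- ★ **THE PERIODIC CUT MEMBER IN NODE N06's CURRENCY**: [B6] (2.2) `Sep22Zd R` at every truncation `m ≤ k` and every `⌈M⌉₊ ≤ M₁` (dag-n05-w2's
`IdxB8SubDPer.sep22Zd_of_admissible134` BY NAME). [cite: Balaban1985RegularSpaces, (1.4) p.77; Balaban1984PropagatorsII, (2.2) p.224] -/
theorem IdxB8SubDPerκ.sep22Zd (j : IdxB8SubDPerκ θ P M₁ R) {m : ℕ} (hm : m ≤ j.1.1.1.1.1.1.k) {M : ℝ} (hM : ⌈M⌉₊ ≤ M₁) : Sep22Zd R (memZd M j.1.1.1.1.1.1 m) :=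
  B8Admissible134Periodize.IdxB8SubDPer.sep22Zd_of_admissible134 j.1 j.2 hm hM

variable (θ)

/-- ★ **THE ℤᵈ CUT IS INHABITED AT EVERY DEPTH**: for `1 ≤ M₁`, `θ.L ≤ R·M₁`, `k ≥ 1` a cut member of depth `k` — print's Sect.-F tower with corner and side multiples of `M₁`,
`ρ = R·M₁` (dag-n05-w2's `exists_idxB8SubD_admissible134` BY NAME). [cite: Balaban1985RegularSpaces, (1.3)–(1.4) p.77, (1.131) p.99, p.98 («ρ = R₁M₁»)] -/
theorem exists_idxB8SubDκ_depth (hM₁ : 1 ≤ M₁) (hRM : θ.L ≤ R * M₁) {k : ℕ} (hk : 1 ≤ k) : ∃ j : IdxB8SubDκ θ M₁ R, j.1.1.1.1.1.k = k := by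
  obtain ⟨j, hjk, hadm⟩ := B8IdxB8SubDPrintClassGap.exists_idxB8SubD_admissible134 θ hM₁ hRM hk
  exact ⟨⟨j, hjk ▸ hadm⟩, hjk⟩

/-- The ℤᵈ cut is non-empty (depth 1). [cite: Balaban1985RegularSpaces, (1.3)–(1.4) p.77] -/
theorem nonempty_idxB8SubDκ (hM₁ : 1 ≤ M₁) (hRM : θ.L ≤ R * M₁) : Nonempty (IdxB8SubDκ θ M₁ R) :=
  let ⟨j, _⟩ := exists_idxB8SubDκ_depth θ hM₁ hRM le_rfl
  ⟨j⟩

/-- ★★ **THE PERIODIC CUT IS INHABITED AT EVERY DEPTH**: for `1 ≤ M₁`, `θ.L ≤ R·M₁`, `k ≥ 1`, `0 < P`, `M₁·θ.Lᵏ ∣ P` a periodic cut member of depth `k` — print's Sect.-F tower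
periodised (dag-n05-w2's A2 `exists_idxB8SubDPer_admissible134` BY NAME): a cut ROW is not vacuous. [cite: Balaban1985RegularSpaces, (1.3)–(1.4) p.77, (1.131) p.99, p.77 («Ω_j ⊂ T_η»)] -/
theorem exists_idxB8SubDPerκ_depth (hM₁ : 1 ≤ M₁) (hRM : θ.L ≤ R * M₁) {k : ℕ} (hk : 1 ≤ k) (hP : 0 < P) (hdvd : M₁ * θ.L ^ k ∣ P) :
    ∃ j : IdxB8SubDPerκ θ P M₁ R, j.1.1.1.1.1.1.k = k := by
  obtain ⟨j, hjk, hadm⟩ := B8Admissible134Periodize.exists_idxB8SubDPer_admissible134 θ hM₁ hRM hk hP hdvd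
  exact ⟨⟨j, hjk ▸ hadm⟩, hjk⟩

/-- The periodic cut is non-empty at every period `P > 0` with `M₁·θ.L ∣ P` (depth 1). [cite: Balaban1985RegularSpaces, (1.3)–(1.4) p.77, p.77 («Ω_j ⊂ T_η»)] -/
theorem nonempty_idxB8SubDPerκ (hM₁ : 1 ≤ M₁) (hRM : θ.L ≤ R * M₁) (hP : 0 < P) (hdvd : M₁ * θ.L ∣ P) : Nonempty (IdxB8SubDPerκ θ P M₁ R) :=
  let ⟨j, _⟩ := exists_idxB8SubDPerκ_depth θ hM₁ hRM le_rfl hP (by simpa using hdvd)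
  ⟨j⟩

end Cut

/-! ## §2. The ℤᵈ P₂D slot of record read on the cut index; implied by the uncut slot -/

section SlotZd

variable {θ : Stage3Params} {M₁ R : ℕ}

/-- ★ **THE ℤᵈ P₂D SLOT OF RECORD WITH ITS INDEX CUT TO PRINT's CLASS**: `CarriersB8SubBP2D.B8LeafOfRecordSubBP₂D θ lam` (Slot8's leaf: `B8LeafRSC` at `c₇OfRecord θ` over the
δ₂-family `famB8OfRecordSubBP₂D`, Proposition 7's axial map PINNED to print's tower-wise map `toAxialTowerResid`) with the family index `IdxB8SubD θ ↦ IdxB8SubDκ θ M₁ R`, every other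
token identical.  A PROPOSITION; what the statement edition A-5 (i) would point Slot8 at (`∃ c₁ ρ₀, 0 < c₁ ∧ 1 ≤ ρ₀ ∧ B8LeafOfRecordSubBP₂Dκ θ M₁ R (λ₈.cutSubBP₅ c₁ ρ₀)`).
[cite: Balaban1985RegularSpaces, Lemma 1 p.79, Thm 2 p.83, Prop. 3 p.87, Thm 4 p.88, Prop. 5 p.94, Prop. 6 p.99, Prop. 7 p.100, Thm 8 p.101, (1.3)–(1.4) p.77] -/
def B8LeafOfRecordSubBP₂Dκ (θ : Stage3Params) (M₁ R : ℕ) (lam : ResidB8 θ) : Prop :=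
  B8LeafRSC θ.D (θ.L : ℝ) lam.C₂ lam.B₁' lam.inp.B₀' lam.B₁ lam.B₂ lam.c₁ lam.inp lam.B₀β (c₇OfRecord θ) (blockPairNA θ.D θ.L θ.𝔸)
    (fun j : IdxB8SubDκ θ M₁ R => famB8OfRecordSubBP₂D θ lam.β lam.len j.1) lam.lan lam.cub (fun j => toAxialTowerResid θ lam.β lam.len j.1.1.1.1)

/-- ★ **THE UNCUT SLOT IMPLIES THE CUT SLOT** (restriction of the family index along `Subtype.val`, conjunct by conjunct BY NAME; the `l1 ∕ p5e ∕ p5u ∕ p6` conjuncts do not read the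
family). [cite: Balaban1985RegularSpaces, Lemma 1 – Thm 8 pp.79–101 (bookkeeping: restriction of the family index)] -/
theorem b8LeafOfRecordSubBP₂Dκ_of_subBP₂D (lam : ResidB8 θ) (h : B8LeafOfRecordSubBP₂D θ lam) : B8LeafOfRecordSubBP₂Dκ θ M₁ R lam where
  l1 := h.l1
  t2 := B8LeafKnit.thm2Printed_precomp (fun j : IdxB8SubDκ θ M₁ R => j.1) (fun j => (famB8OfRecordSubBP₂D θ lam.β lam.len j).toGFData) h.t2
  p3 := B8LeafKnit.prop3Printed_precomp (fun j : IdxB8SubDκ θ M₁ R => j.1) θ.D (θ.L : ℝ) lam.C₂ lam.inp lam.B₀β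
    (fun j => (famB8OfRecordSubBP₂D θ lam.β lam.len j).toGFData2) h.p3
  t4 := B8LeafKnit.thm4Printed_precomp (fun j : IdxB8SubDκ θ M₁ R => j.1) lam.B₁' (fun j => (famB8OfRecordSubBP₂D θ lam.β lam.len j).toGFData) h.t4
  p5e := h.p5e
  p5u := h.p5u
  p6 := h.p6
  p7 := by
    obtain ⟨c, hc, H⟩ := h.p7
    exact ⟨c, hc, fun j => H j.1⟩
  t8 := B8Thm8Surviving.thm8SurvivingAt_precomp (fun j : IdxB8SubDκ θ M₁ R => j.1) 1 lam.B₁ lam.B₂ (fun j => famB8OfRecordSubBP₂D θ lam.β lam.len j) h.t8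

/-- **AT SLOT8's OWN LAYER** `lam.cutSubBP₅ c₁ ρ₀` (the P₅-pinned print-class cut residual layer of `CarriersB8SubBPCutP5`): the slot of record implies the κ-cut slot — the guard
`0 < c₁ ∧ 1 ≤ ρ₀` (director-ym №217 (2)(i) ∕ VERDICT-415) is carried by the consumer, unchanged. [cite: Balaban1985RegularSpaces, Prop. 5 p.94, Prop. 6 p.99, (1.3)–(1.4) p.77] -/
theorem b8LeafOfRecordSubBP₂Dκ_cutSubBP₅_of_subBP₂D (lam : ResidB8 θ) (c₁ : ℝ) (ρ₀ : ℕ) (h : B8LeafOfRecordSubBP₂D θ (lam.cutSubBP₅ c₁ ρ₀)) :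
    B8LeafOfRecordSubBP₂Dκ θ M₁ R (lam.cutSubBP₅ c₁ ρ₀) :=
  b8LeafOfRecordSubBP₂Dκ_of_subBP₂D (lam.cutSubBP₅ c₁ ρ₀) h

/-- The guarded Slot8 text of record implies its κ-cut reading (pure logic under the `∃ c₁ ρ₀` ∕ guard). [cite: Balaban1985RegularSpaces, Prop. 6 p.99, (1.3)–(1.4) p.77 (bookkeeping)] -/
theorem exists_b8LeafOfRecordSubBP₂Dκ_cutSubBP₅_of_subBP₂D (lam : ResidB8 θ)
    (h : ∃ (c₁ : ℝ) (ρ₀ : ℕ), 0 < c₁ ∧ 1 ≤ ρ₀ ∧ B8LeafOfRecordSubBP₂D θ (lam.cutSubBP₅ c₁ ρ₀)) :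
    ∃ (c₁ : ℝ) (ρ₀ : ℕ), 0 < c₁ ∧ 1 ≤ ρ₀ ∧ B8LeafOfRecordSubBP₂Dκ θ M₁ R (lam.cutSubBP₅ c₁ ρ₀) := by
  obtain ⟨c₁, ρ₀, hc₁, hρ₀, hl⟩ := h
  exact ⟨c₁, ρ₀, hc₁, hρ₀, b8LeafOfRecordSubBP₂Dκ_cutSubBP₅_of_subBP₂D lam c₁ ρ₀ hl⟩

/-- The cut slot's index is inhabited whenever `1 ≤ M₁`, `θ.L ≤ R·M₁` (so the cut slot is NOT vacuously true by an empty family). [cite: Balaban1985RegularSpaces, (1.3)–(1.4) p.77] -/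
theorem nonempty_index_b8LeafOfRecordSubBP₂Dκ (hM₁ : 1 ≤ M₁) (hRM : θ.L ≤ R * M₁) : Nonempty (IdxB8SubDκ θ M₁ R) :=
  nonempty_idxB8SubDκ θ hM₁ hRM

end SlotZd

end Literature.MathematicalPhysics.QuantumFieldTheory.Balaban1983to89.Node00

end
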